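import Summits.ResolutionOfSingularities.ResolutionOfSingularities.Theorems.CylinderCutClasses2
import HarnessLib

/-!
# CylinderCutCells — decomp-res node «CylinderCut» (lens-2 g18)

Content VERBATIM from the decomp-res lens-2 g18 node `HOME/decomp-res-lens-2/g18/CylinderCut.lean` (pin d60dded1, 2
862 l; HOME = run/shared/lean/pub/decomp-res);
CRITIC-LEDGER row 150 (+1); landing orders INBOX :446: land the NEW PART ONLY (§C l. 2356–2619 + §U l. 2621–2859) —
the SplitCut restatement §R17 (l. 124–2354, itself
carrying g14–g17 verbatim) is DELETED and the landed modules imported instead (namespaces `…Theorems.PinchCut`,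
`…Theorems.JetCut`, `…Theorems.PurityCut`, `…Theorems.SplitCut`
opened; same short names, byte-identical bodies — never two copies).  Namespace `…Theorems.CylinderCut` (the lens's
`Theses.CylinderCut` is gate-reserved), sub-namespace `Cyl`
as in the lens; file split only (tree files ≤ 400 lines): sections, variables, the mid-file `open MvPolynomial` and
every declaration exactly as in the lens; the node's
global dupNamespace-linter line dropped.  Node files, in import order: `CylinderCutClasses` (§C + the cone-free head
of §U; continued `…2` where the cap cuts) ·
`CylinderCutCells` (§U2–§U4 cone-free: the aside home) · the wiring `MaxContactCutCylinderCut` (§C bridge kernel +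
§U BY NAME on the host route, in the Theses cone; imports
`MaxContactCutSplitCut` and the tree's `MaxContactCutTauLadder` ⊃ `MaxContactCutExhaustion`).  All `--supports
stmt-ResolutionOfSingularities-29273` (`MaxContactCut.RungOne`);
nothing closes 29273 — decided halves carry their engines as hypotheses (`JetCylinderExit` is a PORT: paper proof in
the lens docstring §C.2 / NODE-g18 §2); exactly ONE
located-residual aside on the lens-2 column (`Cyl.CylSpecialRung`, home `CylinderCutCells`) SUPERSEDES g17's
`Split.SplitSpecialRung`, re-located EXACTLY modulo the
cylinder decided half.

§U2–§U4 cone-free part — `namespace Cyl`: the graded statements `SeqCGen` / `SeqCSpec` / …, the rungs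
**`CylGenericRung`** (DECIDED half, engines as hypotheses) / **`CylSpecialRung`** (THE LOCATED RESIDUAL of the node
— the ONE aside on the lens-2 column, SUPERSEDING g17's `Split.SplitSpecialRung`), their `…_iff` with the §G `Leaf`
schema and the hypothesis-free links — statement-level + pure logic; this module is the cone-free aside home.  The
cut BY NAME on the route (`Cyl.rungOne_iff`, `Cyl.closes`, `cylGenericRung_of_ports`, `closes_of_engines`, the §U4
re-locations `splitSpecialRung_iff_cylSpecialRung` etc.) is in `MaxContactCutCylinderCut`.

(Sources: Hironaka1964 Ch. III; CossartJannsenSaito2020 Ch. 2, Ch. 8–9; CossartPiltant2008 Prop. 4.2;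
CossartPiltant2019 Rem. 3.2; BierstoneGrigorievMilmanWlodarczyk2011 §3.1; Moh1987; Hauser2010Kangaroo; Giraud1975;
Narasimhan1983.)
-/

open CategoryTheory AlgebraicGeometry TopologicalSpace IsLocalRing
open Literature.AlgebraicGeometry.Resolution
open Summit.ResolutionOfSingularities.ResolutionOfSingularities.Theorems
open Summit.ResolutionOfSingularities.ResolutionOfSingularities.Theorems.WeakOrderReduction
open Summit.ResolutionOfSingularities.ResolutionOfSingularities.Theorems.DeltaFaceCutClasses
open Summit.ResolutionOfSingularities.ResolutionOfSingularities.Theorems.RelativeDeltaCut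
open Summit.ResolutionOfSingularities.ResolutionOfSingularities.Theorems.CurveLeafExit
open Summit.ResolutionOfSingularities.ResolutionOfSingularities.Theorems.PinchCut
open Summit.ResolutionOfSingularities.ResolutionOfSingularities.Theorems.JetCut
open Summit.ResolutionOfSingularities.ResolutionOfSingularities.Theorems.PurityCut
open Summit.ResolutionOfSingularities.ResolutionOfSingularities.Theorems.SplitCut

namespace Summit.ResolutionOfSingularities.ResolutionOfSingularities.Theorems.CylinderCut

namespace Cyl

/-! ### §U2  The graded statements of the CYLINDER cut (instances of §G with the cylinder leaf) -/

/-- **`SeqCGen n`** — weak order reduction in dimension four at marking `n` for data ALL of whose top points are in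
the decided classes
of g17 or CYLINDER-CURVE / JET-CYLINDER-CURVE points.  [DECIDED-MOD-PORT: `cGenRungAt_of_engines`.]  STATEMENT SCHEMA
(= `Leaf.SeqGen cylLeaf n`). (Sources: BierstoneGrigorievMilmanWlodarczyk2011 §3.1; CossartPiltant2008 Prop. 4.2;
Cutkosky2009 Thm 5.1.) -/
def SeqCGen (n : ℕ) : Prop := Leaf.SeqGen cylLeaf n

/-- **`SeqCSpec n`** — THE LOCATED CLASS: weak order reduction at marking `n` for data having a CYLINDER-SPECIAL core top point.
[UNDECIDED · IDEA-NEEDED.]  STATEMENT SCHEMA (= `Leaf.SeqSpec cylLeaf n`). (Sources: CossartPiltant2019 Rem. 3.2; Moh1987.) -/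
def SeqCSpec (n : ℕ) : Prop := Leaf.SeqSpec cylLeaf n

/-- `CGenRungAt n` — the decided rung at one marking. -/
def CGenRungAt (n : ℕ) : Prop := SeqDimFour 2 n → SeqCGen n

/-- **`CylGenericRung`** — the DECIDED half of `RungOne` (29273) for the cylinder leaf.  [WEAKER · DECIDED-MOD-PORT(M+):
`cylGenericRung_of_engines`.]  STATEMENT (decided piece). (Sources: Cutkosky2009 Thm 5.1; CossartPiltant2008 Prop.
4.2; CossartJannsenSaito2020.) -/
def CylGenericRung : Prop := E 2 → ∀ n : ℕ, 1 ≤ n → SeqCGen n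

/-- **`CylSpecialRung`** — THE LOCATED RESIDUAL of this node: `E 2 →` weak order reduction for every marking and all data with a
cylinder-special core top point.  [WEAKER BY LETTER than `Split.SplitSpecialRung` · UNDECIDED · IDEA-NEEDED ·
cofinal ⇒ score 0.]
STATEMENT (located residual). (Sources: CossartPiltant2019 Rem. 3.2; Moh1987; Giraud1975; Narasimhan1983.) -/
def CylSpecialRung : Prop := E 2 → ∀ n : ℕ, 1 ≤ n → SeqCSpec n

/-- `cylGenericRung_iff`: Auxiliary step of this node's calculus, VERBATIM from the lens file (see the module
docstring); the statement is its type. [folklore] -/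
theorem cylGenericRung_iff : CylGenericRung ↔ Leaf.GenericRung cylLeaf := Iff.rfl

/-- `cylSpecialRung_iff`: Auxiliary step of this node's calculus, VERBATIM from the lens file (see the module
docstring); the statement is its type. [folklore] -/
theorem cylSpecialRung_iff : CylSpecialRung ↔ Leaf.SpecialRung cylLeaf := Iff.rfl

section Kernels

variable {n : ℕ}

/-! ### §U3  Kernels of the CYLINDER cut (instantiated from §G; 0 sorry) -/

/-- **EXACT at each marking**: `SeqDimFour 1 n ⟺ SeqCGen n ∧ SeqCSpec n`. [folklore] -/
theorem seqDimFour_one_iff : SeqDimFour 1 n ↔ SeqCGen n ∧ SeqCSpec n :=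
  Leaf.seqDimFour_one_iff (L := cylLeaf)

/-- Under the engines (M) (C) (G) (S) (Cyl) (JCyl) every point of the cylinder leaf is a curve-exit point. [folklore] -/
theorem isCurveExitPt_of_cylLeaf (hM : MonomialPinchExit) (hC : FlatConeExit) (hGE : GrandExit) (hSE : SplitConeExit)
    (hCE : CylinderExit) (hJE : JetCylinderExit)
    (hn : 2 ≤ n) ⦃Y : Scheme.{0}⦄ (hY : Scheme.IsRegular Y) ⦃I : Y.IdealSheafData⦄ ⦃y : Y⦄ (h : cylLeaf I n y) :
    IsCurveExitPt I n y := by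
  rcases h with h | h | h
  · exact Split.isCurveExitPt_of_splitLeaf hM hC hGE hSE hn hY h
  · exact isCurveExitPt_of_isCylinderCurvePt hCE hY hn h
  · exact isCurveExitPt_of_isJetCylinderCurvePt hJE hY hn h

/-- **THE ENGINES AT WORK**: the five tree engines, (M) (C) (G) (S), the NEW engines (Cyl) (JCyl) and g12's port
give `CGenRungAt n` for
`n ≥ 2`. [folklore] -/
theorem cGenRungAt_of_engines (hV : VeryNearCutClasses.VeryNearExit) (hD : DeltaPackageExit)
    (hU : UniformCurvePackageExit) (hR : RelCurvePackageExit) (hN : NormalConeJumpExit)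
    (hM : MonomialPinchExit) (hC : FlatConeExit) (hGE : GrandExit) (hSE : SplitConeExit)
    (hCE : CylinderExit) (hJE : JetCylinderExit) (hP : CurvePackagePort n) (hn : 2 ≤ n) : CGenRungAt n :=
  Leaf.genRungAt_of_port (L := cylLeaf) hV hD hU hR hN (isCurveExitPt_of_cylLeaf hM hC hGE hSE hCE hJE hn) hP hn

/-- **`CylGenericRung` is DECIDED modulo the typed pieces**: engines (as hypotheses), g12's port at every marking `≥
2`, the order-one
contact port. [folklore] -/
theorem cylGenericRung_of_engines (hV : VeryNearCutClasses.VeryNearExit) (hD : DeltaPackageExit)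
    (hU : UniformCurvePackageExit) (hR : RelCurvePackageExit) (hN : NormalConeJumpExit)
    (hM : MonomialPinchExit) (hC : FlatConeExit) (hGE : GrandExit) (hSE : SplitConeExit)
    (hCE : CylinderExit) (hJE : JetCylinderExit)
    (hP : ∀ n : ℕ, 2 ≤ n → CurvePackagePort n) (h1 : FaceFormCutClasses.OrderOneContact) : CylGenericRung :=
  Leaf.genericRung_of_port (L := cylLeaf) hV hD hU hR hN
    (fun _ hn => isCurveExitPt_of_cylLeaf hM hC hGE hSE hCE hJE hn) hP h1

/-! ### §U4  EXACT RE-LOCATIONS (the residual shrinks; equivalent modulo the cylinder decided half) -/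

/-- **REFINEMENT EDGE (hypothesis-free)**: g17's residual implies g18's — `Split.SplitSpecialRung → CylSpecialRung`
(WEAKER BY LETTER).
[folklore] -/
theorem cylSpecialRung_of_splitSpecialRung (h : Split.SplitSpecialRung) : CylSpecialRung :=
  Leaf.specialRung_mono splitLeaf_le_cylLeaf (Split.splitSpecialRung_iff.mp h)

/-- The cylinder decided half contains g17's: `CylGenericRung → Split.SplitGenericRung`. [folklore] -/
theorem splitGenericRung_of_cylGenericRung (h : CylGenericRung) : Split.SplitGenericRung :=
  Split.splitGenericRung_iff.mpr (Leaf.genericRung_anti splitLeaf_le_cylLeaf h)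

end Kernels

end Cyl

end Summit.ResolutionOfSingularities.ResolutionOfSingularities.Theorems.CylinderCut
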